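import Summits.QuantumFields.YangMills.Theorems.BalabanUVNodesPortS1ChartJacobianFull
import Literature.MathematicalPhysics.QuantumFieldTheory.Balaban1983to89.Node00.RegSetOfFibredChart

/-!
# NODE O port PT-A — FE-1 (T1), the (L1)∘(L2) GLUE ★ of `FIBRE-CHART-LAW-v1` (46338b5b1045e3b8): the CANONICAL TRANSFORM OF RECORD, given a group-level fibred chart `(Φ, J)` of the averaging over an open
# coarse set (dag-n09-w6's door currency ✓`Node00.RegSetOfFibredChart`), IS the (2.10)-shaped integral over DEF-1's FLAT CHART VARIABLES at any (coarse-field-dependent) centre: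
# `TcanOfRecord F 2 K k ρ W = σ₀^{#T_k} · ∫_{window_π} σ(fluctVec x) · J(W, pert (ctr W) x) · ρ(Φ(W, pert (ctr W) x)) dx` on `U₀` — print's «𝐍*∫dB′σ(B′)δ(Q̃(B′))ρ» with the δ solved group-side
# ([I] (2.10) p.267, [16] (16)∕(18) p.259–260), pointwise and choice-free on `U₀`

Cell `ym-nodeO-ideate`, porter seat `ymgap-nodeO-port-PTA-1` (gen 9); `--kind proof --supports stmt-QuantumFields-27930 --as helper` (the P-α pen of `FIBRE-CHART-LAW-v1` §3).  CONSUMED BY NAME: dag-n09-w6 g2's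
✓`Node00.RegSetOfFibredChart.TcanOfRecord_eqOn_fibreIntegral_of_fibredChart` (L1: pointwise fibre-integral formula for `TcanOfRecord` on an open set carrying a fibred chart with `hmap`∕`havgΦ` and a continuous
fibre integral) with the fibre space `Z := GaugeField (F.P K) k (SU 2)`, `τ := fieldMeasure` (the shape of dag-n11's ✓`…N11PrivateChartOfCentralWindow`), and this seat's ✓`…PortS1ChartJacobianFull.
integral_fieldMeasure_eq_chart` (L2: `dU = σ₀^{#T_k} σ(B′)dB′` through `U = exp(iB′)·ctr`, every centre, every a.e.-strongly measurable integrand).  [I] = [Balaban1987RG1]; [16] = [Balaban1985UV3].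

CONTENT (theorems only; no `def`, no `instance`, no `sorry`): `measurable_fibreIntegrand` (bookkeeping), ★★★ `TcanOfRecord_eqOn_chartIntegral_of_fibredChart` (centre = any map `ctr` of the coarse field, e.g. the
axial representative `V^{(k)}_{ax}(W)`), ★★ `TcanOfRecord_eq_chartIntegral_of_fibredChart` (the pointwise form at `W ∈ U₀`).

HONEST FRAMING.  A two-line composition of landed theorems; the fibred chart `(Φ, J)`, its `hmap`∕`havgΦ`, the support clause and the continuity `hgc` are HYPOTHESES here (supplied from numerics by dag-n09∕n11's
✓`…N11PrivateChartOfCentralWindow.exists_chart_transportOfRecord_ae_eq_centralWindow` + ✓`…N09HregOfFibredChartAtRecord` in their own currency — not re-derived); the identification of `(Φ, J)` with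
print's linearised Lie-algebra variables ((o1) `D̃`, (o3)) is NOT here; nothing of Bałaban's estimates asserted, ported or discharged; `stub_P0C` ∕ `stub_FE` OPEN; ⟨27930⟩ ⁸-Ax-LR4 OPEN · no claim; NODE O
0∕1; COUNT 8∕28 · K 1∕4 UNMOVED; finite `𝕋⁴_{L^K}` at fixed ε — NOT continuum ∕ OS ∕ Clay; **the Yang–Mills mass gap is NOT proved by any of this.**  Standard axioms.
-/

noncomputable section

open MeasureTheory Set Metric
open scoped ENNReal NNReal BigOperators

namespace Summit.QuantumFields.YangMills.Theorems.BalabanUVNodesPortS1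

open Literature.MathematicalPhysics.QuantumFieldTheory (haarProbability)
open Literature.MathematicalPhysics.QuantumFieldTheory.Balaban1983to89
open Literature.MathematicalPhysics.QuantumFieldTheory.Balaban1983to89.Node00
open Literature.MathematicalPhysics.QuantumFieldTheory.Balaban1983to89.T4Continuum (T4Family)
open Literature.MathematicalPhysics.QuantumFieldTheory.Balaban1983to89.B10Eq22Rescaling (sigmaSU2)
open Summit.QuantumFields.YangMills.Theorems.K0RecordFormatNames (FluctIdx pert)

variable (F : T4Family)

/-- Bookkeeping: the fibre integrand `U ↦ J(W,U)·ρ(Φ(W,U))` of a measurable chart with a measurable density and a measurable `ρ` is measurable. [folklore] -/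
theorem measurable_fibreIntegrand {K k : ℕ} {ρ : Density (F.P K) k (SU 2)} (hρm : Measurable ρ)
    {Φ : (PBond (F.P K) (k + 1) → SU 2) × GaugeField (F.P K) k (SU 2) → GaugeField (F.P K) k (SU 2)}
    {J : (PBond (F.P K) (k + 1) → SU 2) × GaugeField (F.P K) k (SU 2) → ℝ≥0} (hΦ : Measurable Φ) (hJ : Measurable J) (W : PBond (F.P K) (k + 1) → SU 2) :
    Measurable fun U : GaugeField (F.P K) k (SU 2) => (J (W, U) : ℝ) * ρ (Φ (W, U)) :=
  (measurable_coe_nnreal_real.comp (hJ.comp (measurable_const.prodMk measurable_id))).mul (hρm.comp (hΦ.comp (measurable_const.prodMk measurable_id)))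

/-- ★★★ **THE CANONICAL TRANSFORM OF RECORD IS THE (2.10) CHART INTEGRAL** on any open coarse set `U₀` carrying a group-level fibred chart `(Φ, J)` of the averaging of record (fibre space = the fine
configurations with `dU`; `hmap`, `havgΦ`, support clause `hS`, continuity `hgc` — dag-n09-w6's door currency), for EVERY choice of centre `ctr W` of the Pauli chart on the fibre:
`TcanOfRecord F 2 K k ρ W = σ₀^{#T_k} · ∫_{{x : √(Σ_a x(b,a)²) < π ∀ b}} σ(fluctVec x) · J(W, pert F k K (ctr W) x) · ρ(Φ(W, pert F k K (ctr W) x)) dx`, `W ∈ U₀`.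
[cite: Balaban1987RG1, (2.10) p.267 and (0.19) p.255] [cite: Balaban1985UV3, (16) p.259, (18) p.260] -/
theorem TcanOfRecord_eqOn_chartIntegral_of_fibredChart {K k : ℕ} (hk : k < K) {ρ : Density (F.P K) k (SU 2)}
    (hρ : Integrable ρ (fieldMeasure (F.P K) k (SU 2))) (hρm : Measurable ρ) {U₀ : Set (PBond (F.P K) (k + 1) → SU 2)} (hU : IsOpen U₀)
    {S : Set (GaugeField (F.P K) k (SU 2))} (hS : ∀ x, ρ x ≠ 0 → x ∈ S)
    {Φ : (PBond (F.P K) (k + 1) → SU 2) × GaugeField (F.P K) k (SU 2) → GaugeField (F.P K) k (SU 2)}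
    {J : (PBond (F.P K) (k + 1) → SU 2) × GaugeField (F.P K) k (SU 2) → ℝ≥0}
    (hΦ : Measurable Φ) (hJ : Measurable J) (havgΦ : ∀ V ∈ U₀, ∀ z, (avOfRecord F 2 K k).avg (Φ (V, z)) = V)
    (hmap : (fieldMeasure (F.P K) k (SU 2)).restrict ((avOfRecord F 2 K k).avg ⁻¹' U₀ ∩ S)
      = ((((piHaar (F.P K) (k + 1) (SU 2)).restrict U₀).prod (fieldMeasure (F.P K) k (SU 2))).withDensity (fun p => (J p : ℝ≥0∞))).map Φ)
    (hgc : ContinuousOn (fun V => ∫ z, (J (V, z) : ℝ) * ρ (Φ (V, z)) ∂(fieldMeasure (F.P K) k (SU 2))) U₀)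
    (ctr : (PBond (F.P K) (k + 1) → SU 2) → GaugeField (F.P K) k (SU 2)) :
    EqOn (TcanOfRecord F 2 K k ρ)
      (fun W => (sigmaSU2 0) ^ Fintype.card (PBond (F.P K) k) •
        ∫ x in {x : FluctIdx F k K → ℝ | ∀ b : PBond (F.P K) k, √(∑ a : Fin 3, x (b, a) ^ 2) < Real.pi},
          fluctSigma (fluctVec F k K x) • ((J (W, pert F k K (ctr W) x) : ℝ) * ρ (Φ (W, pert F k K (ctr W) x)))) U₀ := by
  intro W hW
  rw [TcanOfRecord_eqOn_fibreIntegral_of_fibredChart (τ := fieldMeasure (F.P K) k (SU 2)) hk hρ hU hS hΦ hJ havgΦ hmap hgc hW]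
  exact integral_fieldMeasure_eq_chart F K k (ctr W) _ (measurable_fibreIntegrand F hρm hΦ hJ W).aestronglyMeasurable

/-- ★★ The same, pointwise at `W ∈ U₀`. [cite: Balaban1987RG1, (2.10) p.267] [cite: Balaban1985UV3, (18) p.260] -/
theorem TcanOfRecord_eq_chartIntegral_of_fibredChart {K k : ℕ} (hk : k < K) {ρ : Density (F.P K) k (SU 2)}
    (hρ : Integrable ρ (fieldMeasure (F.P K) k (SU 2))) (hρm : Measurable ρ) {U₀ : Set (PBond (F.P K) (k + 1) → SU 2)} (hU : IsOpen U₀)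
    {S : Set (GaugeField (F.P K) k (SU 2))} (hS : ∀ x, ρ x ≠ 0 → x ∈ S)
    {Φ : (PBond (F.P K) (k + 1) → SU 2) × GaugeField (F.P K) k (SU 2) → GaugeField (F.P K) k (SU 2)}
    {J : (PBond (F.P K) (k + 1) → SU 2) × GaugeField (F.P K) k (SU 2) → ℝ≥0}
    (hΦ : Measurable Φ) (hJ : Measurable J) (havgΦ : ∀ V ∈ U₀, ∀ z, (avOfRecord F 2 K k).avg (Φ (V, z)) = V)
    (hmap : (fieldMeasure (F.P K) k (SU 2)).restrict ((avOfRecord F 2 K k).avg ⁻¹' U₀ ∩ S)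
      = ((((piHaar (F.P K) (k + 1) (SU 2)).restrict U₀).prod (fieldMeasure (F.P K) k (SU 2))).withDensity (fun p => (J p : ℝ≥0∞))).map Φ)
    (hgc : ContinuousOn (fun V => ∫ z, (J (V, z) : ℝ) * ρ (Φ (V, z)) ∂(fieldMeasure (F.P K) k (SU 2))) U₀)
    (ctr : (PBond (F.P K) (k + 1) → SU 2) → GaugeField (F.P K) k (SU 2)) {W : PBond (F.P K) (k + 1) → SU 2} (hW : W ∈ U₀) :
    TcanOfRecord F 2 K k ρ W = (sigmaSU2 0) ^ Fintype.card (PBond (F.P K) k) •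
        ∫ x in {x : FluctIdx F k K → ℝ | ∀ b : PBond (F.P K) k, √(∑ a : Fin 3, x (b, a) ^ 2) < Real.pi},
          fluctSigma (fluctVec F k K x) • ((J (W, pert F k K (ctr W) x) : ℝ) * ρ (Φ (W, pert F k K (ctr W) x))) :=
  TcanOfRecord_eqOn_chartIntegral_of_fibredChart F hk hρ hρm hU hS hΦ hJ havgΦ hmap hgc ctr hW

end Summit.QuantumFields.YangMills.Theorems.BalabanUVNodesPortS1

end
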